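import Summits.HubbardSuperconductivity.HubbardSuperconductivity.Theorems.AnisotropyChordTransferBEC
import Summits.HubbardSuperconductivity.HubbardSuperconductivity.Theorems.AnisotropyChordTowerXYAnchor

/-!
# Route `AnisotropyChord` / H0 rotor rung, route (1): the TOLERANCE FORM of THEOREM T — BEC on the first `k` sectors needs
# only a FIXED per-link tower-fidelity defect (theory seat `hubbard-h0-rotor-theory-1` g12, memo ROTOR-THEORY-12 §184(j),
# cell INBOX l.481 item (2a); prover seat `hubbard-h0-rotor-p1` g15)

THEOREM T (`transferTheorem_holds`) concludes `∀ ε > 0, FirstLinksUpTo Δ ε k` and for that genuinely needs the link fidelities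
`F_j = towerFidelity ψ_j ψ_{j+1} → 1`.  BEC (`CondensateOnFirstSectors Δ k`) does NOT: the landed TRANSFER inequality
`⟨S⃗²⟩_{ψ_{j+1}} ≥ ⟨S⃗²⟩_{ψ_j} − (1 − F_j)‖S⁺ψ_j‖²` loses at most `(1 − F_j)·|V|²` per link against the anchor `⟨S⃗²⟩_{ψ_0} ≥ c₀|V|²`, so a
fixed defect `1 − F_j ≤ δ` with `kδ < c₀` suffices.

* `TowerFidelityDefect Δ δ k` — eventually in `L`, `1 − towerFidelity ψ_j ψ_{j+1} ≤ δ` on the links `j < k`;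
* `firstLinksUpTo_of_fidelityDefect` — `TowerFidelityDefect Δ δ k`, `0 ≤ δ < 1` ⇒ `FirstLinksUpTo Δ (kδ) k` (any `Δ`);
* **`condensateOnFirstSectors_of_fidelityDefect`** — `HalfFillingAnchor Δ c₀` + `TowerFidelityDefect Δ δ k` with `kδ < c₀`, `δ < 1`
  ⇒ `CondensateOnFirstSectors Δ k` (any `Δ`; at `Δ = 0` the anchor is KLS in the tree: `condensateOnFirstSectors_xy_of_fidelityDefect`).

Kinematic (no Hamiltonian input beyond the Perron amplitudes); complements the `O(1/|V|)`-window theorem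
`condensateOnWindow_of_towerFidelity` (`…TowerLadder`). All folklore-level bookkeeping on the landed TRANSFER inequality.
-/

set_option linter.dupNamespace false
set_option autoImplicit false

noncomputable section

open Finset Filter Topology
open Literature.MathematicalPhysics.QuantumLattice Literature.Probability.LatticeModels
open Summit.HubbardSuperconductivity.HubbardSuperconductivity.Theorems.AnisotropyChord.InsertionEntropy
open Summit.HubbardSuperconductivity.HubbardSuperconductivity.Theorems.AnisotropyChord.Tower

namespace Summit.HubbardSuperconductivity.HubbardSuperconductivity.Theorems.AnisotropyChord.Transfer

/-- **HYPOTHESIS (tower-fidelity defect `≤ δ` on the first `k` links):** eventually in `L`, for `j < k` and the Perron amplitudes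
`b` (sector `j`), `a` (sector `j + 1`): `1 − towerFidelity b a ≤ δ` (`towerFidelity b a = ⟨a, S⁺b⟩²/‖S⁺b‖²`).
[conjecture: theory seat hubbard-h0-rotor-theory-1, cycle 12, memo §184(j) — hypothesis shape of the tolerance form of THEOREM T] -/
def TowerFidelityDefect (Δ δ : ℝ) (k : ℕ) : Prop :=
  ∀ᶠ L : ℕ in atTop, ∀ [NeZero L], ∀ j : ℕ, j < k →
    ∀ b a : TensorIndex (TorusSite 2 L) 2 → ℝ,
      IsPerronSectorGroundAmplitude L Δ (j : ℝ) b → IsPerronSectorGroundAmplitude L Δ ((j : ℝ) + 1) a →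
        1 - towerFidelity b a ≤ δ

variable {L : ℕ} [NeZero L]

/-- `‖S⁺a‖² ≤ |V|²` for a Perron amplitude of an integer sector `j`. [folklore] -/
theorem raiseNormSq_le_card_sq {Δ : ℝ} {j : ℕ} {a : TensorIndex (TorusSite 2 L) 2 → ℝ}
    (ha : IsPerronSectorGroundAmplitude L Δ (j : ℝ) a) :
    raiseNormSq a ≤ (Fintype.card (TorusSite 2 L) : ℝ) ^ 2 := by
  have h1 := raiseNormSq_eq_totalSpinSq ha
  have h2 := totalSpinSq_le_top ha
  have hV1 : (1 : ℝ) ≤ (Fintype.card (TorusSite 2 L) : ℝ) := by exact_mod_cast Fintype.card_pos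
  have hj : (0 : ℝ) ≤ j := Nat.cast_nonneg _
  nlinarith [h1, h2, hV1, hj, sq_nonneg (j : ℝ)]

/-- a positive tower fidelity forces `S⁺b ≠ 0`. [folklore] -/
theorem raiseNormSq_pos_of_towerFidelity_pos {b a : TensorIndex (TorusSite 2 L) 2 → ℝ} (h : 0 < towerFidelity b a) :
    0 < raiseNormSq b := by
  have h0 : 0 ≤ raiseNormSq b := Finset.sum_nonneg fun σ _ => sq_nonneg _
  rcases eq_or_lt_of_le h0 with hz | hpos
  · exfalso
    have : towerFidelity b a = 0 := by unfold towerFidelity; rw [← hz, div_zero]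
    rw [this] at h; exact lt_irrefl _ h
  · exact hpos

/-- **TOLERANCE FORM, link by link:** a tower-fidelity defect `≤ δ < 1` on the links `j < k` gives `FirstLinksUpTo Δ (kδ) k`
(each link loses at most `δ‖S⁺ψ_j‖² ≤ δ|V|²` of `⟨S⃗²⟩`; TRANSFER = `spinSquaredTransfer_holds`). Any anisotropy `Δ`.
[conjecture: theory seat hubbard-h0-rotor-theory-1, cycle 12, memo §184(j) — tolerance form of THEOREM T; Lean proof here] -/
theorem firstLinksUpTo_of_fidelityDefect {Δ δ : ℝ} {k : ℕ} (hδ0 : 0 ≤ δ) (hδ1 : δ < 1)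
    (h : TowerFidelityDefect Δ δ k) : FirstLinksUpTo Δ ((k : ℝ) * δ) k := by
  have hT : ∀ᶠ L : ℕ in atTop, 2 * k ≤ L := Filter.eventually_ge_atTop _
  filter_upwards [h, hT] with L hL hTL
  intro _ j hj a₀ a ha₀ ha
  set V : ℝ := (Fintype.card (TorusSite 2 L) : ℝ) with hVdef
  -- Perron amplitudes in the sectors 0 … k
  have hexN : ∀ i : ℕ, i ≤ k → ∃ b : TensorIndex (TorusSite 2 L) 2 → ℝ,
      IsPerronSectorGroundAmplitude L Δ (i : ℝ) b := fun i hi =>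
    exists_perron_nat ha₀ i (le_trans (by omega) (le_trans hTL (Nat.le_self_pow two_ne_zero L)))
  choose! ψ hψ using hexN
  have hψ0 : IsPerronSectorGroundAmplitude L Δ 0 (ψ 0) := by
    have := hψ 0 (Nat.zero_le _); rwa [Nat.cast_zero] at this
  have ea₀ : a₀ = ψ 0 := perron_eq ha₀ hψ0
  have ea : a = ψ j := perron_eq ha (hψ j hj)
  rw [ea₀, ea]
  -- induction along the links
  have key : ∀ i, i ≤ k →
      Summit.HubbardSuperconductivity.HubbardSuperconductivity.Theorems.AnisotropyChord.Tower.totalSpinSq (ψ 0) 0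
        - (i : ℝ) * δ * V ^ 2
      ≤ Summit.HubbardSuperconductivity.HubbardSuperconductivity.Theorems.AnisotropyChord.Tower.totalSpinSq (ψ i) (i : ℝ) := by
    intro i
    induction i with
    | zero => intro _; simp
    | succ i ih =>
      intro hi
      have hi' : i < k := by omega
      have ih' := ih (by omega)
      have hψi := hψ i (by omega)
      have hψi1 : IsPerronSectorGroundAmplitude L Δ ((i : ℝ) + 1) (ψ (i + 1)) := by
        have := hψ (i + 1) hi; push_cast at this; exact this
      have hdef := hL i hi' (ψ i) (ψ (i + 1)) hψi hψi1
      have hZpos : 0 < towerFidelity (ψ i) (ψ (i + 1)) := by linarith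
      have hN := raiseNormSq_pos_of_towerFidelity_pos hZpos
      have htr := spinSquaredTransfer_holds L (i : ℝ) (ψ i) (ψ (i + 1)) hψi.sector hψi.unit hψi1.unit hN
      have hNle : raiseNormSq (ψ i) ≤ V ^ 2 := raiseNormSq_le_card_sq hψi
      have hloss : (1 - towerFidelity (ψ i) (ψ (i + 1))) * raiseNormSq (ψ i) ≤ δ * V ^ 2 := by
        have h1 : 0 ≤ 1 - towerFidelity (ψ i) (ψ (i + 1)) := by
          have := towerFidelity_le (ψ i) (ψ (i + 1)); rw [hψi1.unit] at this; linarith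
        calc (1 - towerFidelity (ψ i) (ψ (i + 1))) * raiseNormSq (ψ i) ≤ δ * raiseNormSq (ψ i) :=
              mul_le_mul_of_nonneg_right hdef hN.le
          _ ≤ δ * V ^ 2 := mul_le_mul_of_nonneg_left hNle hδ0
      push_cast at htr ⊢
      linarith
  have hmain := key j hj
  have hjk : (j : ℝ) * δ * V ^ 2 ≤ (k : ℝ) * δ * V ^ 2 := by
    have : (j : ℝ) ≤ k := by exact_mod_cast hj
    have hV2 : 0 ≤ δ * V ^ 2 := by positivity
    nlinarith
  linarith

/-- `FirstLinksUpTo` is monotone in the tolerance. [folklore] -/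
theorem firstLinksUpTo_mono {Δ ε ε' : ℝ} {k : ℕ} (hε : ε ≤ ε') (h : FirstLinksUpTo Δ ε k) : FirstLinksUpTo Δ ε' k := by
  filter_upwards [h] with L hL
  intro _ j hj a₀ a ha₀ ha
  have := hL j hj a₀ a ha₀ ha
  have hV : 0 ≤ (Fintype.card (TorusSite 2 L) : ℝ) ^ 2 := sq_nonneg _
  nlinarith

/-- **TOLERANCE FORM OF THEOREM T (BEC end):** half-filling anchor `c₀` + a tower-fidelity defect `δ` on the first `k` links
with `kδ < c₀`, `δ < 1` ⇒ `CondensateOnFirstSectors Δ k` — BEC on the first `k` sectors needs a FIXED per-link fidelity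
defect, not `F_j → 1`. Any anisotropy `Δ`. [conjecture: theory seat hubbard-h0-rotor-theory-1, cycle 12, memo §184(j); Lean proof here] -/
theorem condensateOnFirstSectors_of_fidelityDefect {Δ c₀ δ : ℝ} {k : ℕ} (hc₀ : 0 < c₀) (hδ0 : 0 ≤ δ) (hδ1 : δ < 1)
    (hkδ : (k : ℝ) * δ < c₀) (hA : HalfFillingAnchor Δ c₀) (h : TowerFidelityDefect Δ δ k) :
    CondensateOnFirstSectors Δ k := by
  have hlinks : FirstLinksUpTo Δ (max ((k : ℝ) * δ) (c₀ / 2)) k :=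
    firstLinksUpTo_mono (le_max_left _ _) (firstLinksUpTo_of_fidelityDefect hδ0 hδ1 h)
  refine firstLinksGiveCondensate_holds Δ _ c₀ k (lt_of_lt_of_le (by linarith) (le_max_right _ _))
    (max_lt hkδ (by linarith)) hA ?_ ?_ hlinks
  · exact Filter.Eventually.of_forall fun L _ hL => exists_perron_zero_of_even Δ hL
  · exact Filter.Eventually.of_forall fun L _ hL j a ha => hL (even_of_perron_nat ha)

/-- **… with the explicit admissible defect `δ = c₀/(k + 1)`** (`c₀ < 1` is automatic for a condensate density but kept as a
hypothesis). [folklore] -/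
theorem condensateOnFirstSectors_of_fidelityDefect_explicit {Δ c₀ : ℝ} {k : ℕ} (hc₀ : 0 < c₀) (hc₁ : c₀ < 1)
    (hA : HalfFillingAnchor Δ c₀) (h : TowerFidelityDefect Δ (c₀ / ((k : ℝ) + 1)) k) :
    CondensateOnFirstSectors Δ k := by
  have hk1 : (0 : ℝ) < (k : ℝ) + 1 := by positivity
  refine condensateOnFirstSectors_of_fidelityDefect hc₀ (by positivity) ?_ ?_ hA h
  · rw [div_lt_one hk1]; have : (0 : ℝ) ≤ k := Nat.cast_nonneg _; linarith
  · rw [mul_div_assoc', div_lt_iff₀ hk1]; nlinarith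

/-- **XY point:** for hard-core bosons on `(ℤ/L)²` there is `δ₀ > 0` (from the KLS anchor constant, tree `halfFillingAnchor_xy`)
such that a tower-fidelity defect `≤ δ ≤ δ₀` on the first `k` links gives BEC in the sectors `N = L²/2 + j`, `j ≤ k`. [folklore] -/
theorem condensateOnFirstSectors_xy_of_fidelityDefect (k : ℕ) :
    ∃ δ₀ > (0 : ℝ), ∀ δ : ℝ, 0 ≤ δ → δ ≤ δ₀ → TowerFidelityDefect 0 δ k → CondensateOnFirstSectors 0 k := by
  obtain ⟨c₀, hc₀, hA⟩ := halfFillingAnchor_xy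
  have hk1 : (0 : ℝ) < (k : ℝ) + 1 := by positivity
  refine ⟨min (c₀ / ((k : ℝ) + 1)) (1 / 2), lt_min (by positivity) (by norm_num), fun δ hδ0 hδ hT => ?_⟩
  have h1 : δ ≤ c₀ / ((k : ℝ) + 1) := le_trans hδ (min_le_left _ _)
  have h2 : δ ≤ 1 / 2 := le_trans hδ (min_le_right _ _)
  refine condensateOnFirstSectors_of_fidelityDefect hc₀ hδ0 (by linarith) ?_ hA hT
  have h3 : (k : ℝ) * (c₀ / ((k : ℝ) + 1)) < c₀ := by
    rw [mul_div_assoc', div_lt_iff₀ hk1]; nlinarith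
  have hk0 : (0 : ℝ) ≤ k := Nat.cast_nonneg _
  nlinarith

end Summit.HubbardSuperconductivity.HubbardSuperconductivity.Theorems.AnisotropyChord.Transfer
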